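import Summits.MatrixMultiplication.OmegaCensus.DicyclicTwoSetTools
import HarnessLib

/-!
# Preliminaries for the `C₂ × Q₁₆` shape exclusions

ω-census, family (b3).  Framing: lottery ticket; floor = certified bounds/negative ranges.

`pairs_of_sum_injOn_fst` (pairwise injectivity of `Y + Z` from a box `{x} × Y × Z`) and `proj84_eq_iff` (fibres of the
projection `ℤ₂ × ℤ₈ → ℤ₂ × ℤ₄`, by `decide`), used by `C2Quaternion16ShapeD.lean`.
-/

namespace Summit.MatrixMultiplication.OmegaCensus

open Literature.Combinatorics.Additive Finset

section Pairs

variable {A : Type*} [AddCommGroup A] [DecidableEq A]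

omit [DecidableEq A] in
/-- Pairwise injectivity of `Y + Z` from `Set.InjOn` on the box `{x} × Y × Z`. [folklore] -/
theorem pairs_of_sum_injOn_fst {x : A} {Y Z : Finset A}
    (h : Set.InjOn (fun p : A × A × A => p.1 + p.2.1 + p.2.2) ↑(({x} : Finset A) ×ˢ Y ×ˢ Z)) :
    ∀ y ∈ Y, ∀ y' ∈ Y, ∀ z ∈ Z, ∀ z' ∈ Z, y + z = y' + z' → y = y' ∧ z = z' := by
  intro y hy y' hy' z hz z' hz' he
  have h1 : ((x, y, z) : A × A × A) ∈ (↑(({x} : Finset A) ×ˢ Y ×ˢ Z) : Set (A × A × A)) := by simp [hy, hz]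
  have h2 : ((x, y', z') : A × A × A) ∈ (↑(({x} : Finset A) ×ˢ Y ×ˢ Z) : Set (A × A × A)) := by simp [hy', hz']
  have key := h h1 h2 (by show x + y + z = x + y' + z'; rw [add_assoc, he, ← add_assoc])
  simp only [Prod.mk.injEq] at key
  exact ⟨key.2.1, key.2.2⟩

end Pairs

/-- Fibres of the projection `ℤ₂ × ℤ₈ → ℤ₂ × ℤ₄`: `π x = π y ↔ y ∈ {x, x + (0,4)}`. [folklore] -/
theorem proj84_eq_iff : ∀ x y : ZMod 2 × ZMod 8,
    ((AddMonoidHom.fst (ZMod 2) (ZMod 8)).prod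
      ((ZMod.castHom (show 4 ∣ 8 by norm_num) (ZMod 4)).toAddMonoidHom.comp (AddMonoidHom.snd (ZMod 2) (ZMod 8)))) x =
    ((AddMonoidHom.fst (ZMod 2) (ZMod 8)).prod
      ((ZMod.castHom (show 4 ∣ 8 by norm_num) (ZMod 4)).toAddMonoidHom.comp (AddMonoidHom.snd (ZMod 2) (ZMod 8)))) y ↔
    (y = x ∨ y = x + ((0 : ZMod 2), (4 : ZMod 8))) := by
  decide

end Summit.MatrixMultiplication.OmegaCensus
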